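import Mathlib
import Summits.ResolutionOfSingularities.ResolutionOfSingularities.Theorems.RadicialJungCleanModelsCleanProp44CurveSliceMin
import Summits.ResolutionOfSingularities.ResolutionOfSingularities.Theorems.RadicialJungCleanModelsCleanProp44CurveVeryNear
import Literature.AlgebraicGeometry.Resolution.GenericPointStalkData
import HarnessLib

/-!
# Route `RadicialJung`, crux `CleanModels` (stmt-ResolutionOfSingularities-15917), line `Sketch` rev 35, stub 6 `stub_cleanProp44` (X44c):
# THIRTEENTH CUT — X44c ⟸ (R1ᵐⁱⁿ) ∧ (R3ᵐⁱⁿ): both research hypotheses of stub 6 at their MINIMAL stages for the printed potentials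

Seat decomp-res-hand-2 g17, companion of ✓ `…CleanProp44CurveSliceMin.lean` (`exists_isCleanPermissibleSeq_lt_of_curve_of_minimal`: the global clean
curve slice from its `λ`-minimal residual (R3ᵐⁱⁿ)) and of the twelfth cut ✓ `cleanProp44_of_phaseTwoMin_of_curveTauOneVN : (R1ᵐⁱⁿ) → (R3ᵛⁿ′) → X44c`.

* `curveTauOneVN_of_curveMin` — **(R3ᵛⁿ′) ⟸ (R3ᵐⁱⁿ)**: the `V`-relative clean curve slice `hcurveTauOneVN` of the tenth/twelfth cuts (VERBATIM) from
  the global `λ`-minimal residual: transport the standing hypotheses to the open subscheme `V` (as in ✓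
  `exists_isCleanPermissibleSeq_lt_comap_of_curve_of_cleanPermissible_of_forall_near_two_le`), where `Y ⊆ V` contains the whole `m`-stratum and its
  generic point has codimension `2` (the regular pair of parameters, ✓ `IsRsopPart.ringKrullDim_quotient_add`), and run
  ✓ `exists_isCleanPermissibleSeq_lt_of_curve_of_minimal` there.
* `cleanProp44_of_phaseTwoMin_of_curveMin` — **THIRTEENTH CUT: X44c (`stub_cleanProp44`, verbatim) ⟸ (R1ᵐⁱⁿ) ∧ (R3ᵐⁱⁿ)**.

NET for the planner (repair census of stub 6, by name): X44c ⟸ (R1ᵐⁱⁿ) clean Phase II at the `Λ`-minimal no-bad stages with a crossing ∧ (R3ᵐⁱⁿ) the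
clean curve slice at the `λ`-minimal curve situations with a `τ = 1` point that are not (clean-permissible without very near point) — in both, every
clean-permissible detour that would let the PRINTED induction of [CoP1] Prop. 4.4 continue is excluded by hypothesis; what is left is the births
world (memo 4e §2.4–2.6): forced insertions and very near points.  RE-LINE proposal: `stub_cleanProp44 :=
cleanProp44_of_phaseTwoMin_of_curveMin stub_cleanPhaseTwoMin stub_cleanCurveMin`.

Honest framing: OURS; (R1ᵐⁱⁿ) and (R3ᵐⁱⁿ) are NOT proved here; nothing here proves X44c, any case of `CleanModels`, or resolution of singularities
in characteristic `p`. [cite: CossartPiltant2008, Prop. 4.2 (b), Prop. 4.4 (proof, pp. 10–11), Lemma 4.3, Lemma 4.5] [cite: CossartJannsenSaito2020, Thm. 13.7]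
[cite: Piltant2013, §2 Axiom 4, Prop. 5.1 (proof, Step 2)]
-/

noncomputable section

set_option linter.dupNamespace false -- mandated namespace of this single-conjunct summit

open CategoryTheory CategoryTheory.Limits AlgebraicGeometry TopologicalSpace IsLocalRing
open Literature.AlgebraicGeometry.Resolution Literature.AlgebraicGeometry.Motives
open Scheme.IdealSheafData
open Summit.ResolutionOfSingularities.ResolutionOfSingularities.Theorems.CP2008Prop44

namespace Summit.ResolutionOfSingularities.ResolutionOfSingularities.Theorems.RadicialJung.CleanModels

/-! ## §1 (R3ᵛⁿ′) ⟸ (R3ᵐⁱⁿ): the `V`-relative consumer from the global `λ`-minimal residual -/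

set_option maxHeartbeats 1600000 in
-- transport of the standing hypotheses to the open subscheme, long binder lists
/-- **(R3ᵛⁿ′) ⟸ (R3ᵐⁱⁿ)**: the hypothesis `hcurveTauOneVN` of ✓ `cleanProp44_of_phaseTwo_of_curveTauOneVN` / ✓ `cleanProp44_of_phaseTwoMin_of_curveTauOneVN`
(VERBATIM) follows from the global `λ`-minimal residual (R3ᵐⁱⁿ) (hypothesis schema of ✓ `exists_isCleanPermissibleSeq_lt_of_curve_of_minimal`, quantified
over the prime and the order).  See the module docstring. [cite: CossartPiltant2008, Prop. 4.4 (proof, pp. 10–11)] [cite: Piltant2013, Prop. 5.1 (proof, Step 2)] -/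
theorem curveTauOneVN_of_curveMin
    (hcurveMin : ∀ (p : ℕ), p.Prime → ∀ {X : Scheme.{0}} [IsIntegral X] [IsNoetherian X], CharP X.functionField p →
      ∀ (hX : Scheme.IsRegular X), Scheme.IsQuasiExcellent X → topologicalKrullDim X ≤ 3 →
      ∀ (G : X.functionField), (∀ x : X, CleanRegAt p (algebraMap (X.presheaf.stalk x) X.functionField) G) →
      ∀ (J : X.IdealSheafData) {m : ℕ}, 1 ≤ m → (∀ z, idealOrder J z ≤ m) → (∀ z ∈ J.support, 1 < Order.coheight z) →
      ∀ (η : X), ¬ IsClosed ({η} : Set X) →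
        Scheme.IsRegular (vanishingIdeal (⟨closure {η}, isClosed_closure⟩ : Closeds X)).subscheme →
        (∀ z : X, (m : ℕ∞) ≤ idealOrder J z → z ∈ closure ({η} : Set X)) →
        (∀ y ∈ closure ({η} : Set X), idealOrder J y = m) →
      -- (τ1) some closed threefold point of order `m` has `τ = 1`
      ¬ (∀ x : X, IsClosed ({x} : Set X) → idealOrder J x = m → (maximalIdeal (X.presheaf.stalk x)).spanFinrank = 3 →
          ∀ hr : IsRegularLocalRing (X.presheaf.stalk x), 2 ≤ @stalkTau X J x hr m) →
      -- (vn′) NOT (clean-permissible along the curve AND no very near point over it)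
      ¬ ((∀ y ∈ closure ({η} : Set X), CleanPermissibleAt p (algebraMap (X.presheaf.stalk y) X.functionField) G
            (stalkIdeal (vanishingIdeal (⟨closure {η}, isClosed_closure⟩ : Closeds X)) y)) ∧
          (∀ (X₉ : Scheme.{0}) (π : X₉ ⟶ X), IsBlowup π (vanishingIdeal (⟨closure {η}, isClosed_closure⟩ : Closeds X)) →
            ∀ x' : X₉, IsClosed ({x'} : Set X₉) → π x' ∈ closure ({η} : Set X) →
              idealOrder (controlledTransform π (vanishingIdeal (⟨closure {η}, isClosed_closure⟩ : Closeds X)) J m) x' = m →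
              (maximalIdeal (X₉.presheaf.stalk x')).spanFinrank = 3 →
              ∀ hr : IsRegularLocalRing (X₉.presheaf.stalk x'),
                2 ≤ @stalkTau X₉ (controlledTransform π (vanishingIdeal (⟨closure {η}, isClosed_closure⟩ : Closeds X)) J m) x' hr m)) →
      -- (min) `λ` does not drop along any clean-permissible sequence reaching a curve situation
      (∀ (X₁ : Scheme.{0}) [IsIntegral X₁] (Φ : X₁ ⟶ X) [IsDominant Φ] (J₁ : X₁.IdealSheafData),
        IsCleanPermissibleSeq p Φ J m J₁ G → ∀ η₁ : X₁,
        ¬ IsClosed ({η₁} : Set X₁) →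
        Scheme.IsRegular (vanishingIdeal (⟨closure {η₁}, isClosed_closure⟩ : Closeds X₁)).subscheme →
        (∀ z : X₁, (m : ℕ∞) ≤ idealOrder J₁ z → z ∈ closure ({η₁} : Set X₁)) →
        (∀ y ∈ closure ({η₁} : Set X₁), idealOrder J₁ y = m) →
        (Module.length (X.presheaf.stalk η) (X.presheaf.stalk η ⧸ stalkIdeal J η)).toNat ≤
          (Module.length (X₁.presheaf.stalk η₁) (X₁.presheaf.stalk η₁ ⧸ stalkIdeal J₁ η₁)).toNat) →
      ∃ (X' : Scheme.{0}) (π : X' ⟶ X) (_ : IsIntegral X') (_ : IsDominant π) (J' : X'.IdealSheafData),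
        IsCleanPermissibleSeq p π J m J' G ∧ ∀ x, idealOrder J' x < m) :
    ∀ (p : ℕ), p.Prime → ∀ {X : Scheme.{0}} [IsIntegral X] [IsNoetherian X], CharP X.functionField p →
      ∀ (hX : Scheme.IsRegular X), Scheme.IsQuasiExcellent X → topologicalKrullDim X ≤ 3 →
      ∀ (G : X.functionField), (∀ x : X, CleanRegAt p (algebraMap (X.presheaf.stalk x) X.functionField) G) →
      ∀ (J : X.IdealSheafData) {m : ℕ}, 1 ≤ m → (∀ z, idealOrder J z ≤ m) → (∀ z ∈ J.support, 1 < Order.coheight z) →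
      ∀ (V : X.Opens) (Y : Closeds X), Scheme.IsRegular (vanishingIdeal Y).subscheme → IsIrreducible (Y : Set X) →
      (Y : Set X) ⊆ (V : Set X) → (∀ z : X, (m : ℕ∞) ≤ idealOrder J z → z ∈ (Y : Set X) ∨ z ∉ (V : Set X)) →
      (∀ y ∈ (Y : Set X), idealOrder J y = m) →
      (∀ y ∈ (Y : Set X), haveI := hX y; ∃ c : Fin 2 → X.presheaf.stalk y, IsRsopPart c ∧
        Ideal.span (Set.range c) = stalkIdeal (vanishingIdeal Y) y) →
      (¬ ∀ y ∈ (Y : Set X), IsClosed ({y} : Set X) → haveI := hX y; 2 ≤ stalkTau J y m) →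
      -- (VN′) NOT (clean-permissible at every point of `Y` AND no very near point over `Y` for the blowing ups of `X` along `Y`)
      (¬ ((∀ y ∈ (Y : Set X), CleanPermissibleAt p (algebraMap (X.presheaf.stalk y) X.functionField) G (stalkIdeal (vanishingIdeal Y) y)) ∧
          (∀ (X₁ : Scheme.{0}) (π : X₁ ⟶ X), IsBlowup π (vanishingIdeal Y) →
            ∀ x' : X₁, IsClosed ({x'} : Set X₁) → π x' ∈ (Y : Set X) →
              idealOrder (controlledTransform π (vanishingIdeal Y) J m) x' = m →
              (maximalIdeal (X₁.presheaf.stalk x')).spanFinrank = 3 →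
              ∀ hr : IsRegularLocalRing (X₁.presheaf.stalk x'), 2 ≤ @stalkTau X₁ (controlledTransform π (vanishingIdeal Y) J m) x' hr m))) →
      ∀ [IsIntegral ((V : X.Opens) : Scheme.{0})] [IsDominant V.ι],
      ∃ (V' : Scheme.{0}) (π : V' ⟶ V) (_ : IsIntegral V') (_ : IsDominant π) (K' : V'.IdealSheafData),
        IsCleanPermissibleSeq p π (J.comap V.ι) m K' (RatFn.functionFieldMap V.ι G) ∧ ∀ y, idealOrder K' y < m := by
  intro p hp X _ _ hchar hX hqe hX3 G hG J m hm hle hcodim V Y hYreg hirr hYV hJY hordY hrsop _ _ hVint hVdom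
  haveI := hchar
  haveI := hVint
  haveI := hVdom
  -- the open subscheme `V` inherits the standing hypotheses (as in ✓ `…_of_curve_of_cleanPermissible_of_forall_near_two_le`)
  haveI : CompactSpace (V : Scheme.{0}) :=
    ⟨(V.ι.isOpenEmbedding.isInducing.isCompact_iff).mpr (NoetherianSpace.isCompact _)⟩
  haveI : IsNoetherian (V : Scheme.{0}) := {}
  have hV : Scheme.IsRegular (V : Scheme.{0}) := Scheme.IsRegular.of_isOpenImmersion V.ι hX
  have hqeV : Scheme.IsQuasiExcellent (V : Scheme.{0}) := Scheme.IsQuasiExcellent.of_locallyOfFiniteType V.ι hqe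
  have hcohV : ∀ v : (V : Scheme.{0}), Order.coheight v = Order.coheight (V.ι v) := fun v =>
    CampaignW46.coheight_eq_of_isIso_stalkMap V.ι v
  have hcoh3 : ∀ z : X, Order.coheight z ≤ 3 := (topologicalKrullDim_le_iff_forall_coheight_le X 3).mp hX3
  have hV3 : topologicalKrullDim (V : Scheme.{0}) ≤ 3 :=
    (topologicalKrullDim_le_iff_forall_coheight_le _ 3).mpr fun v => (hcohV v).symm ▸ hcoh3 _
  haveI hcharV : CharP (V : Scheme.{0}).functionField p := charP_of_injective_ringHom (RatFn.functionFieldMap V.ι).injective p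
  have hGV : ∀ v : (V : Scheme.{0}), CleanRegAt p (algebraMap ((V : Scheme.{0}).presheaf.stalk v) (V : Scheme.{0}).functionField)
      (RatFn.functionFieldMap V.ι G) := fun v =>
    CleanRegAt.functionFieldMap_of_isIso_stalkMap V.ι v (hG (V.ι v))
  have hordV : ∀ v : (V : Scheme.{0}), idealOrder (J.comap V.ι) v = idealOrder J (V.ι v) := fun v =>
    idealOrder_comap_of_isOpenImmersion V.ι J v
  have hleV : ∀ v : (V : Scheme.{0}), idealOrder (J.comap V.ι) v ≤ m := fun v => by rw [hordV]; exact hle _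
  have hcodimV : ∀ v ∈ (J.comap V.ι).support, 1 < Order.coheight v := by
    intro v hv
    rw [← one_le_idealOrder_iff, hordV, one_le_idealOrder_iff] at hv
    rw [hcohV]
    exact hcodim _ hv
  have hmemV : ∀ v : (V : Scheme.{0}), V.ι v ∈ (V : Set X) := fun v => by
    rw [← Scheme.Opens.range_ι V]; exact ⟨v, rfl⟩
  -- the curve seen in `V`
  set YV : Closeds (V : Scheme.{0}) := Y.preimage V.ι.continuous with hYVdef
  have hmemYV : ∀ v : (V : Scheme.{0}), v ∈ (YV : Set (V : Scheme.{0})) ↔ V.ι v ∈ (Y : Set X) := fun v => by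
    rw [hYVdef, Closeds.coe_preimage]; rfl
  have hCW : (vanishingIdeal Y).comap V.ι = vanishingIdeal YV := comap_vanishingIdeal_of_isOpenImmersion V.ι Y
  have hYVreg : Scheme.IsRegular (vanishingIdeal YV).subscheme := by
    rw [← hCW]
    exact isRegular_subscheme_comap_of_isOpenImmersion V.ι (vanishingIdeal Y) hYreg
  -- the generic point `η` of `Y` (inside `V`, as `Y ⊆ V`) and its lift `ηV`
  let η : X := hirr.genericPoint
  have hYη : (Y : Set X) = closure {η} := (hirr.closure_genericPoint Y.isClosed).symm
  have hηY : η ∈ (Y : Set X) := by rw [hYη]; exact subset_closure rfl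
  let ηV : (V : Scheme.{0}) := ⟨η, hYV hηY⟩
  have hιη : V.ι ηV = η := rfl
  have hclV : closure ({ηV} : Set (V : Scheme.{0})) = (YV : Set (V : Scheme.{0})) := by
    have h1 : V.ι ⁻¹' ({η} : Set X) = {ηV} := by
      ext v
      simp only [Set.mem_preimage, Set.mem_singleton_iff]
      constructor
      · intro hv
        exact V.ι.isOpenEmbedding.injective (hv.trans hιη.symm)
      · rintro rfl
        exact hιη
    rw [← h1, ← V.ι.isOpenEmbedding.isOpenMap.preimage_closure_eq_closure_preimage V.ι.continuous, ← hYη, hYVdef,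
      Closeds.coe_preimage]
  have hYVeq : (⟨closure {ηV}, isClosed_closure⟩ : Closeds (V : Scheme.{0})) = YV := Closeds.ext hclV
  have hYreg' : Scheme.IsRegular (vanishingIdeal (⟨closure {ηV}, isClosed_closure⟩ : Closeds (V : Scheme.{0}))).subscheme := by
    rw [hYVeq]; exact hYVreg
  have hstr : ∀ z : (V : Scheme.{0}), (m : ℕ∞) ≤ idealOrder (J.comap V.ι) z → z ∈ closure ({ηV} : Set (V : Scheme.{0})) := by
    intro z hz
    rw [hclV]
    rcases hJY (V.ι z) (by rw [← hordV]; exact hz) with h | h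
    · exact (hmemYV z).mpr h
    · exact absurd (hmemV z) h
  have hord' : ∀ y ∈ closure ({ηV} : Set (V : Scheme.{0})), idealOrder (J.comap V.ι) y = m := fun y hy => by
    rw [hordV]
    rw [hclV] at hy
    exact hordY _ ((hmemYV y).mp hy)
  -- `codim η = 2`: the regular pair of parameters at `η` generates the maximal ideal
  haveI := hX η
  have hcohη : Order.coheight η = 2 := by
    obtain ⟨c, hcr, hcY⟩ := hrsop η hηY
    rw [stalkIdeal_vanishingIdeal_eq_maximalIdeal_of_closure_eq hYη] at hcY
    have hq := hcr.ringKrullDim_quotient_add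
    rw [hcY] at hq
    letI := Ideal.Quotient.field (maximalIdeal (X.presheaf.stalk η))
    rw [ringKrullDim_eq_zero_of_field, zero_add, ringKrullDim_stalk_eq_coheight] at hq
    have h2 : ((Order.coheight η : ℕ∞) : WithBot ℕ∞) = ((2 : ℕ∞) : WithBot ℕ∞) := hq.symm.trans (by rfl)
    exact WithBot.coe_injective h2
  have hcohηV : Order.coheight ηV = 2 := by rw [hcohV, hιη, hcohη]
  -- the global clean curve slice on `V` from the `λ`-minimal residual
  exact exists_isCleanPermissibleSeq_lt_of_curve_of_minimal hp hV hqeV hV3 (RatFn.functionFieldMap V.ι G) hGV (J.comap V.ι) hm hleV hcodimV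
    ηV hYreg' hstr hord' hcohηV
    (fun hch hX₁ hqe₁ hX3₁ G₁ hG₁ J₁ hle₁ hcod₁ η₁ hcl₁ hreg₁ hstr₁ hord₁ hτ hvn hmin =>
      hcurveMin p hp hch hX₁ hqe₁ hX3₁ G₁ hG₁ J₁ hm hle₁ hcod₁ η₁ hcl₁ hreg₁ hstr₁ hord₁ hτ hvn hmin)

/-! ## §2 THIRTEENTH CUT: X44c ⟸ (R1ᵐⁱⁿ) ∧ (R3ᵐⁱⁿ) -/

set_option maxHeartbeats 1600000 in
-- long binder lists
/-- **THE CLEAN ASSEMBLY, THIRTEENTH CUT: X44c (`stub_cleanProp44`, verbatim) ⟸ (R1ᵐⁱⁿ) clean Phase II of reach-tidy at its `Λ`-minimal stages ∧ (R3ᵐⁱⁿ)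
the clean curve slice at its `λ`-minimal curve situations** — ✓ `cleanProp44_of_phaseTwoMin_of_curveTauOneVN` with its hypothesis `hcurveTauOneVN`
NARROWED to `hcurveMin` by `curveTauOneVN_of_curveMin`.  Both research hypotheses of stub 6 are now stated at the stages where the PRINTED inductions
of [CoP1] Prop. 4.4 (the potential of step 3; the colength above the generic point) cannot be continued by any clean-permissible detour.
[cite: CossartPiltant2008, Prop. 4.2 (b), Prop. 4.4 (proof, pp. 10–11), Lemma 4.5] [cite: CossartJannsenSaito2020, Thm. 13.7]
[cite: Piltant2013, §2 Axiom 4, Prop. 5.1 (proof, Step 2)] -/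
theorem cleanProp44_of_phaseTwoMin_of_curveMin
    (hphaseTwoMin : ∀ (p : ℕ), p.Prime → ∀ {X : Scheme.{0}} [IsIntegral X] [IsNoetherian X], CharP X.functionField p →
      ∀ (hX : Scheme.IsRegular X), Scheme.IsQuasiExcellent X → topologicalKrullDim X ≤ 3 →
      ∀ (G : X.functionField), (∀ x : X, CleanRegAt p (algebraMap (X.presheaf.stalk x) X.functionField) G) →
      ∀ (J : X.IdealSheafData) {μ : ℕ}, 1 ≤ μ → (∀ z, idealOrder J z ≤ μ) → (∀ z ∈ J.support, 1 < Order.coheight z) →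
      (∀ x : X, ¬ ∃ C ∈ {C : Closeds X | ∃ ζ ∈ maxPoints {z : X | (μ : ℕ∞) ≤ idealOrder J z},
          ¬ IsClosed ({ζ} : Set X) ∧ C = ⟨closure {ζ}, isClosed_closure⟩},
        x ∈ (vanishingIdeal C).subschemeι '' (Scheme.regularLocus (vanishingIdeal C).subscheme)ᶜ ∨
        (x ∈ (C : Set X) ∧ ∃ C' ∈ {C : Closeds X | ∃ ζ ∈ maxPoints {z : X | (μ : ℕ∞) ≤ idealOrder J z},
            ¬ IsClosed ({ζ} : Set X) ∧ C = ⟨closure {ζ}, isClosed_closure⟩}, C' ≠ C ∧ x ∈ (C' : Set X) ∧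
          stalkIdeal (vanishingIdeal C) x ⊔ stalkIdeal (vanishingIdeal C') x ≠ maximalIdeal (X.presheaf.stalk x))) →
      -- (meet) two distinct curves of `Σ` meet
      (∃ ζ₁ ζ₂ : X, (μ : ℕ∞) ≤ idealOrder J ζ₁ ∧ Order.coheight ζ₁ = 2 ∧ ¬ IsClosed ({ζ₁} : Set X) ∧
          (μ : ℕ∞) ≤ idealOrder J ζ₂ ∧ Order.coheight ζ₂ = 2 ∧ ¬ IsClosed ({ζ₂} : Set X) ∧ ζ₁ ≠ ζ₂ ∧
          ¬ Disjoint (closure ({ζ₁} : Set X)) (closure {ζ₂})) →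
      -- (min) `Λ` does not drop along any clean-permissible sequence reaching a stage without bad points
      (∀ (X₁ : Scheme.{0}) [IsIntegral X₁] (Φ : X₁ ⟶ X) [IsDominant Φ] (J₁ : X₁.IdealSheafData),
        IsCleanPermissibleSeq p Φ J μ J₁ G →
        (∀ x : X₁, ¬ ∃ C ∈ {C : Closeds X₁ | ∃ ζ ∈ maxPoints {z : X₁ | (μ : ℕ∞) ≤ idealOrder J₁ z},
            ¬ IsClosed ({ζ} : Set X₁) ∧ C = ⟨closure {ζ}, isClosed_closure⟩},
          x ∈ (vanishingIdeal C).subschemeι '' (Scheme.regularLocus (vanishingIdeal C).subscheme)ᶜ ∨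
          (x ∈ (C : Set X₁) ∧ ∃ C' ∈ {C : Closeds X₁ | ∃ ζ ∈ maxPoints {z : X₁ | (μ : ℕ∞) ≤ idealOrder J₁ z},
              ¬ IsClosed ({ζ} : Set X₁) ∧ C = ⟨closure {ζ}, isClosed_closure⟩}, C' ≠ C ∧ x ∈ (C' : Set X₁) ∧
            stalkIdeal (vanishingIdeal C) x ⊔ stalkIdeal (vanishingIdeal C') x ≠ maximalIdeal (X₁.presheaf.stalk x))) →
        (∑ᶠ ζ ∈ {ζ : X | ζ ∈ maxPoints {z : X | (μ : ℕ∞) ≤ idealOrder J z} ∧ ¬ IsClosed ({ζ} : Set X)},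
            (Module.length (X.presheaf.stalk ζ) (X.presheaf.stalk ζ ⧸ stalkIdeal J ζ)).toNat) ≤
          (∑ᶠ ζ ∈ {ζ : X₁ | ζ ∈ maxPoints {z : X₁ | (μ : ℕ∞) ≤ idealOrder J₁ z} ∧ ¬ IsClosed ({ζ} : Set X₁)},
              (Module.length (X₁.presheaf.stalk ζ) (X₁.presheaf.stalk ζ ⧸ stalkIdeal J₁ ζ)).toNat)) →
      ∃ (X₁ : Scheme.{0}) (Φ : X₁ ⟶ X) (_ : IsIntegral X₁) (_ : IsDominant Φ) (J₁ : X₁.IdealSheafData)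
        (_ : IsCleanPermissibleSeq p Φ J μ J₁ G),
        (∀ ζ : X₁, (μ : ℕ∞) ≤ idealOrder J₁ ζ → Order.coheight ζ = 2 → ¬ IsClosed ({ζ} : Set X₁) →
            Scheme.IsRegular (vanishingIdeal (⟨closure {ζ}, isClosed_closure⟩ : Closeds X₁)).subscheme) ∧
        (∀ ζ₁ ζ₂ : X₁, (μ : ℕ∞) ≤ idealOrder J₁ ζ₁ → Order.coheight ζ₁ = 2 → ¬ IsClosed ({ζ₁} : Set X₁) →
            (μ : ℕ∞) ≤ idealOrder J₁ ζ₂ → Order.coheight ζ₂ = 2 → ¬ IsClosed ({ζ₂} : Set X₁) → ζ₁ ≠ ζ₂ →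
            Disjoint (closure ({ζ₁} : Set X₁)) (closure {ζ₂})))
    (hcurveMin : ∀ (p : ℕ), p.Prime → ∀ {X : Scheme.{0}} [IsIntegral X] [IsNoetherian X], CharP X.functionField p →
      ∀ (hX : Scheme.IsRegular X), Scheme.IsQuasiExcellent X → topologicalKrullDim X ≤ 3 →
      ∀ (G : X.functionField), (∀ x : X, CleanRegAt p (algebraMap (X.presheaf.stalk x) X.functionField) G) →
      ∀ (J : X.IdealSheafData) {m : ℕ}, 1 ≤ m → (∀ z, idealOrder J z ≤ m) → (∀ z ∈ J.support, 1 < Order.coheight z) →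
      ∀ (η : X), ¬ IsClosed ({η} : Set X) →
        Scheme.IsRegular (vanishingIdeal (⟨closure {η}, isClosed_closure⟩ : Closeds X)).subscheme →
        (∀ z : X, (m : ℕ∞) ≤ idealOrder J z → z ∈ closure ({η} : Set X)) →
        (∀ y ∈ closure ({η} : Set X), idealOrder J y = m) →
      -- (τ1) some closed threefold point of order `m` has `τ = 1`
      ¬ (∀ x : X, IsClosed ({x} : Set X) → idealOrder J x = m → (maximalIdeal (X.presheaf.stalk x)).spanFinrank = 3 →
          ∀ hr : IsRegularLocalRing (X.presheaf.stalk x), 2 ≤ @stalkTau X J x hr m) →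
      -- (vn′) NOT (clean-permissible along the curve AND no very near point over it)
      ¬ ((∀ y ∈ closure ({η} : Set X), CleanPermissibleAt p (algebraMap (X.presheaf.stalk y) X.functionField) G
            (stalkIdeal (vanishingIdeal (⟨closure {η}, isClosed_closure⟩ : Closeds X)) y)) ∧
          (∀ (X₉ : Scheme.{0}) (π : X₉ ⟶ X), IsBlowup π (vanishingIdeal (⟨closure {η}, isClosed_closure⟩ : Closeds X)) →
            ∀ x' : X₉, IsClosed ({x'} : Set X₉) → π x' ∈ closure ({η} : Set X) →
              idealOrder (controlledTransform π (vanishingIdeal (⟨closure {η}, isClosed_closure⟩ : Closeds X)) J m) x' = m →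
              (maximalIdeal (X₉.presheaf.stalk x')).spanFinrank = 3 →
              ∀ hr : IsRegularLocalRing (X₉.presheaf.stalk x'),
                2 ≤ @stalkTau X₉ (controlledTransform π (vanishingIdeal (⟨closure {η}, isClosed_closure⟩ : Closeds X)) J m) x' hr m)) →
      -- (min) `λ` does not drop along any clean-permissible sequence reaching a curve situation
      (∀ (X₁ : Scheme.{0}) [IsIntegral X₁] (Φ : X₁ ⟶ X) [IsDominant Φ] (J₁ : X₁.IdealSheafData),
        IsCleanPermissibleSeq p Φ J m J₁ G → ∀ η₁ : X₁,
        ¬ IsClosed ({η₁} : Set X₁) →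
        Scheme.IsRegular (vanishingIdeal (⟨closure {η₁}, isClosed_closure⟩ : Closeds X₁)).subscheme →
        (∀ z : X₁, (m : ℕ∞) ≤ idealOrder J₁ z → z ∈ closure ({η₁} : Set X₁)) →
        (∀ y ∈ closure ({η₁} : Set X₁), idealOrder J₁ y = m) →
        (Module.length (X.presheaf.stalk η) (X.presheaf.stalk η ⧸ stalkIdeal J η)).toNat ≤
          (Module.length (X₁.presheaf.stalk η₁) (X₁.presheaf.stalk η₁ ⧸ stalkIdeal J₁ η₁)).toNat) →
      ∃ (X' : Scheme.{0}) (π : X' ⟶ X) (_ : IsIntegral X') (_ : IsDominant π) (J' : X'.IdealSheafData),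
        IsCleanPermissibleSeq p π J m J' G ∧ ∀ x, idealOrder J' x < m) :
    ∀ (p : ℕ), p.Prime → ∀ (S : Scheme.{0}) [IsIntegral S] [IsNoetherian S],
      CharP S.functionField p → Scheme.IsRegular S → Scheme.IsExcellent S → topologicalKrullDim S = 3 →
      ∀ G₀ : S.functionField, (∀ s : S, CleanRegAt p (algebraMap (S.presheaf.stalk s) S.functionField) G₀) →
      ∀ I : S.IdealSheafData, I ≠ ⊥ →
      ∀ (X : Scheme.{0}) (ρ : X ⟶ S) [IsIntegral X] [IsNoetherian X] [IsDominant ρ],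
        IsCleanRegularCentreBlowupSeq p ρ I G₀ →
        (∀ x : X, CleanRegAt p (algebraMap (X.presheaf.stalk x) X.functionField) (RatFn.functionFieldMap ρ G₀)) →
        ∀ (J : X.IdealSheafData) (μ : ℕ), 1 ≤ μ →
          (∀ x ∈ J.support, 1 < Order.coheight x) → (∀ x, idealOrder J x ≤ μ) → (∃ x, idealOrder J x = μ) →
          ∃ (X' : Scheme.{0}) (π : X' ⟶ X) (_ : IsIntegral X') (_ : IsDominant π) (J' : X'.IdealSheafData),
            IsCleanPermissibleSeq p π J μ J' (RatFn.functionFieldMap ρ G₀) ∧ ∀ x, idealOrder J' x < μ :=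
  cleanProp44_of_phaseTwoMin_of_curveTauOneVN hphaseTwoMin (curveTauOneVN_of_curveMin hcurveMin)

end Summit.ResolutionOfSingularities.ResolutionOfSingularities.Theorems.RadicialJung.CleanModels

end
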